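import Mathlib.AlgebraicTopology.FundamentalGroupoid.FundamentalGroup
import Mathlib.Topology.Homotopy.Product
import Mathlib.Analysis.Convex.Contractible
import Mathlib.Analysis.Normed.Module.Connected
import Mathlib.Analysis.SpecialFunctions.Complex.Circle
import Mathlib.Algebra.Group.Subgroup.Basic
import Literature.Topology.FourManifolds.CappellShaneson
import Literature.Topology.FourManifolds.CircleSurgeryExistence
import Literature.Topology.FourManifolds.TorusCoordinates
import Literature.Topology.FourManifolds.SphereSimplyConnected
import Literature.Topology.FourManifolds.GluckTwistSimplyConnected
import HarnessLib

/-!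
# Cappell–Shaneson spheres are simply connected: reduction to the group of the section circle

First file of the decomposition (D-0014 `provefact`, size XL) of the named fact
`Literature.Topology.FourManifolds.simplyConnectedSpace_of_isCappellShanesonSphere` of
`Literature.Topology.FourManifolds.CappellShaneson` (*every Cappell–Shaneson sphere is simply
connected*; Cappell–Shaneson, *Some new four-manifolds*, Ann. of Math. 104 (1976), §2). A
Cappell–Shaneson sphere `X` (`Literature.Topology.FourManifolds.IsCappellShanesonSphere`) is obtained from a mapping torus `T`
of the linear diffeomorphism `torusDiffeomorph A` of `T³`, `A ∈ SL(3, ℤ)`, `det (A - 1) = ±1`, by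
surgery on the section circle `c` through the fixed point `1`: in the tree's open relational model,
`X` is the open gluing of `T ∖ c(𝕊¹)` and `D̊² × 𝕊²` along `circleSurgeryRel ν` for an open
tubular neighbourhood `ν : 𝕊¹ × ℝ³ ↪ T` of `c`.

This file reduces the statement to ONE named fact about `T` alone and proves everything else:

* **named fact** `Literature.Topology.FourManifolds.CappellShaneson.normalClosure_pushOff_eq_top`: for the data above and any
  `w ≠ 0`, `π₁(T ∖ c(𝕊¹), ν((1, 0), w))` is the normal closure of the class of the push-off loop
  `t ↦ ν((cos 2πt, sin 2πt), w)` of `c` (`Literature.Topology.FourManifolds.CircleNbhd.pushOff`). This is the fundamental-group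
  content of the assertion, printed without proof in all sources, that the surgery produces a
  simply connected manifold ("homotopy sphere") iff `det (A - 1) = ±1` (Cappell–Shaneson 1976,
  §2; Gompf, Algebr. Geom. Topol. 10 (2010), §2, p. 1667; Gompf, Topology Appl. 38 (1991),
  introduction; Aitchison–Rubinstein, Contemp. Math. 35 (1984), §1). Its proof (universal cover
  `ℝ × (ℝ³ ∖ ℤ³)` of `T ∖ c` with deck group `ℤ³ ⋊_A ℤ`, Hatcher Prop. 1.40, and the computation
  `(ℤ³ ⋊_A ℤ)/⟨⟨(n₀, ±1)⟩⟩ = ℤ³/(A - 1)ℤ³ = 0`) is the object of the sibling files of this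
  decomposition; see the docstring of the fact.
* **proved** `Literature.Topology.FourManifolds.CappellShaneson.simplyConnectedSpace_of_isCappellShanesonSphere_of`: the target
  from the named fact. The printed argument (Gompf–Stipsicz, *4-Manifolds and Kirby Calculus*,
  §5.2; Hatcher, *Algebraic Topology*, Lemma 1.15): `X = U ∪ V` with `U = jA'(T ∖ c)`,
  `V = jB'(D̊² × 𝕊²)` open, `U ∩ V = jA'(ν(𝕊¹ × (B³ ∖ 0)))` path connected; loops in `V` are
  null-homotopic because `D̊² × 𝕊²` is simply connected (`π₁(𝕊²) = 1`,
  `Literature.Topology.FourManifolds.simplyConnectedSpace_euclideanSphere`); a loop in `U` is `jA' ∘ δ` for a loop `δ` of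
  `T ∖ c`, whose class lies in the normal closure of the push-off, and `jA' ∘ pushOff` runs in
  `U ∩ V ⊆ V`, so `(jA')_*` is trivial; Hatcher's Lemma 1.15
  (`Literature.Topology.FourManifolds.simplyConnectedSpace_of_isOpen_cover_of_loops`, `GluckTwistSimplyConnected.lean`, built on
  `Literature.Topology.FourManifolds.Path.Homotopic.refl_of_isOpen_cover_two`, `SphereSimplyConnected.lean`) concludes.

## Other results (all proved)

* `Literature.Topology.FourManifolds.CappellShaneson.isPathConnected_compl_singleton_prod` (complement of a point in a
  product). The easy half of van Kampen and the product lemma are those of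
  `GluckTwistSimplyConnected.lean` (`Literature.Topology.FourManifolds.simplyConnectedSpace_of_isOpen_cover_of_loops`,
  `Literature.Topology.FourManifolds.simplyConnectedSpace_prod`), not re-proved.
* `Literature.Topology.FourManifolds.CappellShaneson.isPathConnected_compl_one_threeTorus`: `T³ ∖ 1` is path connected;
  `Literature.Topology.FourManifolds.CappellShaneson.jA_mem_section_iff`, `Literature.Topology.FourManifolds.CappellShaneson.jB_mem_section_iff`,
  `Literature.Topology.FourManifolds.CappellShaneson.compl_section_eq`, `Literature.Topology.FourManifolds.CappellShaneson.isPathConnected_compl_section`: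
  the complement of the section circle of the glued mapping torus is
  `jA((T³ ∖ 1) × (0,1)) ∪ jB((T³ ∖ 1) × (1/2,3/2))`, hence path connected (this gives
  `PathConnectedSpace ↥ν.complement` in the reduction; the membership lemmas are reused by
  `CappellShanesonProofs.lean`).
* `Literature.Topology.FourManifolds.CircleNbhd.tubePt`, `Literature.Topology.FourManifolds.CircleNbhd.pushOff`: points `ν(u, w)`, `w ≠ 0`, of the
  complement of the core circle and the push-off loop `𝕊¹ × {w}` (tubes `CircleNbhd (𝓡 4) c` in a
  4-manifold, as in `CircleSurgeryExistence.lean`).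
* `Literature.Topology.FourManifolds.CappellShaneson.isPathConnected_puncturedBall`, `…isPathConnected_puncturedTube`,
  `Literature.CappellShaneson.discTimesSphereHomeo : D̊² × 𝕊² ≃ₜ B² × 𝕊²`,
  `Literature.Topology.FourManifolds.CappellShaneson.simplyConnectedSpace_discTimesSphere`.

## References

* S. E. Cappell, J. L. Shaneson, *Some new four-manifolds*, Ann. of Math. 104 (1976) 61–72, §2
  [CappellShanesonAnnals1976] (not held at the time of writing; the construction is recalled in
  the three sources below, which all state the homotopy-sphere property without proof).
* R. E. Gompf, *More Cappell–Shaneson spheres are standard*, Algebr. Geom. Topol. 10 (2010)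
  1665–1681, §2 [GompfAGT2010].
* R. E. Gompf, *On Cappell–Shaneson 4-spheres*, Topology Appl. 38 (1991) 123–136, introduction.
* I. R. Aitchison, J. H. Rubinstein, *Fibered knots and involutions on homotopy spheres*, in
  *Four-Manifold Theory*, Contemp. Math. 35 (1984) 1–74, §1.
* A. Hatcher, *Algebraic Topology* (2002), Lemma 1.15, Prop. 1.12, Prop. 1.14, Prop. 1.40
  [HatcherAT2002].
* R. Gompf, A. Stipsicz, *4-Manifolds and Kirby Calculus* (1999), §5.2.

## Design notes

* The named fact is stated for exactly the data packaged in `Literature.Topology.FourManifolds.IsCappellShanesonSphereOf`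
  (`T : Type`, the explicit-witness gluing `IsOpenGluingWith`, the section circle `c` named through
  `jA`, `jB`, an arbitrary `ν : CircleNbhd (𝓡 4) c`, i.e. either framing) so that the reduction
  is a direct instantiation; it holds for every `w ≠ 0` and does not depend on the framing (two
  push-offs differ by a loop in `ν(𝕊¹ × (ℝ³ ∖ 0)) ≃ 𝕊¹ × 𝕊²`, where they are homotopic).
* No declaration in this file uses `sorry`.
-/

noncomputable section

open Set Function unitInterval
open scoped Manifold ContDiff Topology Real

namespace Literature.Topology.FourManifolds

/-- Local notation: `𝔼 n` is the model Euclidean space `EuclideanSpace ℝ (Fin n)`. -/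
local notation "𝔼 " n:arg => EuclideanSpace ℝ (Fin n)

/-- Local notation: `𝕊 n` is the unit sphere in `EuclideanSpace ℝ (Fin (n + 1))`. -/
local notation "𝕊 " n:arg => (Metric.sphere (0 : EuclideanSpace ℝ (Fin (n + 1))) 1)

/-- Local notation: the model with corners `𝓣 = (𝓡 1).prod ((𝓡 1).prod (𝓡 1))` of `ThreeTorus`. -/
local notation "𝓣" =>
  (ModelWithCorners.prod (𝓡 1) (ModelWithCorners.prod (𝓡 1) (𝓡 1)))

namespace CappellShaneson

/-! ### General helpers -/

section General

variable {X : Type*} [TopologicalSpace X]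

/-- The complement of a point `(y₀, z₀)` of a product is path connected as soon as both factors
are path connected and both punctured factors `Y ∖ {y₀}`, `Z ∖ {z₀}` are path connected and
nonempty: it is the union of `(Y ∖ {y₀}) × Z` and `Y × (Z ∖ {z₀})`, which meet. [folklore] -/
theorem isPathConnected_compl_singleton_prod {Y Z : Type*} [TopologicalSpace Y]
    [TopologicalSpace Z] [PathConnectedSpace Y] [PathConnectedSpace Z] {y₀ : Y} {z₀ : Z}
    (hY : IsPathConnected ({y₀}ᶜ : Set Y)) (hZ : IsPathConnected ({z₀}ᶜ : Set Z)) :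
    IsPathConnected ({(y₀, z₀)}ᶜ : Set (Y × Z)) := by
  obtain ⟨y₁, hy₁⟩ := hY.nonempty
  obtain ⟨z₁, hz₁⟩ := hZ.nonempty
  have h1 : IsPathConnected (({y₀}ᶜ : Set Y) ×ˢ (univ : Set Z)) := hY.prod isPathConnected_univ
  have h2 : IsPathConnected ((univ : Set Y) ×ˢ ({z₀}ᶜ : Set Z)) := isPathConnected_univ.prod hZ
  have h := h1.union h2 ⟨(y₁, z₁), ⟨hy₁, mem_univ _⟩, ⟨mem_univ _, hz₁⟩⟩
  convert h using 1
  ext ⟨y, z⟩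
  simp only [mem_compl_iff, mem_singleton_iff, Prod.mk.injEq, not_and, mem_union, mem_prod,
    mem_univ, and_true, true_and]
  tauto

end General

/-! ### The punctured 3-torus and the complement of the section circle are path connected -/

section Torus

/-- The 3-torus minus its identity element is path connected (it is the union of the three
path-connected sets `{zᵢ ≠ 1}`, each a product of a punctured circle with a 2-torus). [folklore] -/
theorem isPathConnected_compl_one_threeTorus : IsPathConnected ({1}ᶜ : Set ThreeTorus) := by
  have hC : IsPathConnected ({1}ᶜ : Set Circle) := Circle.isPathConnected_compl_singleton 1
  have h2 : IsPathConnected ({1}ᶜ : Set (Circle × Circle)) := by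
    rw [show (1 : Circle × Circle) = (1, 1) from rfl]
    exact isPathConnected_compl_singleton_prod hC hC
  rw [show (1 : ThreeTorus) = ((1 : Circle), (1 : Circle × Circle)) from rfl]
  exact isPathConnected_compl_singleton_prod hC h2

end Torus

section SectionComplement

variable {A : Matrix.SpecialLinearGroup (Fin 3) ℤ} {T : Type*} [TopologicalSpace T]
  [ChartedSpace (𝔼 4) T]
  {jA : ThreeTorus × ↥mappingTorusPieceOne → T} {jB : ThreeTorus × ↥mappingTorusPieceTwo → T}

/-- A point `jA (z, s)` of the first cylinder lies on the section circle
`jA ({1} × (0,1)) ∪ jB ({1} × (1/2, 3/2))` iff `z = 1` (the monodromy fixes `1` and the gluing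
maps are injective). [folklore] -/
theorem jA_mem_section_iff
    (hT : IsOpenGluingWith (ModelWithCorners.prod 𝓣 𝓘(ℝ, ℝ)) (ModelWithCorners.prod 𝓣 𝓘(ℝ, ℝ))
      (𝓡 4) (mappingTorusRel ⇑(torusDiffeomorph A)) jA jB) (z : ThreeTorus)
    (s : ↥mappingTorusPieceOne) :
    jA (z, s) ∈ jA '' ({1} ×ˢ univ) ∪ jB '' ({1} ×ˢ univ) ↔ z = 1 := by
  obtain ⟨hAe, -, -, -, -, hR⟩ := hT
  have hinjA := hAe.isEmbedding.injective
  constructor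
  · rintro (⟨⟨z', s'⟩, ⟨hz', -⟩, h⟩ | ⟨⟨z', t⟩, ⟨hz', -⟩, h⟩)
    · rw [mem_singleton_iff] at hz'
      subst hz'
      exact ((Prod.ext_iff.1 (hinjA h)).1).symm
    · rw [mem_singleton_iff] at hz'
      subst hz'
      rcases (hR (z, s) (1, t)).1 h.symm with ⟨-, h1⟩ | ⟨-, h1⟩
      · exact h1.symm
      · rw [← torusDiffeomorph_apply_one A] at h1
        exact (torusDiffeomorph A).injective h1.symm
  · rintro rfl
    exact Or.inl ⟨(1, s), ⟨rfl, mem_univ _⟩, rfl⟩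

/-- A point `jB (z, t)` of the second cylinder lies on the section circle iff `z = 1`.
[folklore] -/
theorem jB_mem_section_iff
    (hT : IsOpenGluingWith (ModelWithCorners.prod 𝓣 𝓘(ℝ, ℝ)) (ModelWithCorners.prod 𝓣 𝓘(ℝ, ℝ))
      (𝓡 4) (mappingTorusRel ⇑(torusDiffeomorph A)) jA jB) (z : ThreeTorus)
    (t : ↥mappingTorusPieceTwo) :
    jB (z, t) ∈ jA '' ({1} ×ˢ univ) ∪ jB '' ({1} ×ˢ univ) ↔ z = 1 := by
  obtain ⟨-, -, hBe, -, -, hR⟩ := hT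
  have hinjB := hBe.isEmbedding.injective
  constructor
  · rintro (⟨⟨z', s⟩, ⟨hz', -⟩, h⟩ | ⟨⟨z', t'⟩, ⟨hz', -⟩, h⟩)
    · rw [mem_singleton_iff] at hz'
      subst hz'
      rcases (hR (1, s) (z, t)).1 h with ⟨-, h1⟩ | ⟨-, h1⟩
      · exact h1
      · exact h1.trans (torusDiffeomorph_apply_one A)
    · rw [mem_singleton_iff] at hz'
      subst hz'
      exact ((Prod.ext_iff.1 (hinjB h)).1).symm
  · rintro rfl
    exact Or.inr ⟨(1, t), ⟨rfl, mem_univ _⟩, rfl⟩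

/-- **The complement of the section circle of a Cappell–Shaneson mapping torus.** If `T` is glued
from the cylinders `T³ × (0, 1)` and `T³ × (1/2, 3/2)` along `mappingTorusRel (torusDiffeomorph A)`
by `jA`, `jB`, then the complement of the section `jA ({1} × (0,1)) ∪ jB ({1} × (1/2, 3/2))`
through the fixed point `1` is the union of the images of the punctured cylinders
`(T³ ∖ 1) × (0, 1)` and `(T³ ∖ 1) × (1/2, 3/2)` (the monodromy fixes `1` and is injective).
[folklore] -/
theorem compl_section_eq
    (hT : IsOpenGluingWith (ModelWithCorners.prod 𝓣 𝓘(ℝ, ℝ)) (ModelWithCorners.prod 𝓣 𝓘(ℝ, ℝ))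
      (𝓡 4) (mappingTorusRel ⇑(torusDiffeomorph A)) jA jB) :
    (jA '' ({1} ×ˢ univ) ∪ jB '' ({1} ×ˢ univ))ᶜ =
      jA '' ({1}ᶜ ×ˢ univ) ∪ jB '' ({1}ᶜ ×ˢ univ) := by
  have hAsec := jA_mem_section_iff hT
  have hBsec := jB_mem_section_iff hT
  obtain ⟨-, -, -, -, hcov, -⟩ := hT
  ext x
  have hx : x ∈ range jA ∪ range jB := by rw [hcov]; exact mem_univ x
  constructor
  · intro hxc
    rcases hx with ⟨⟨z, s⟩, rfl⟩ | ⟨⟨z, t⟩, rfl⟩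
    · exact Or.inl ⟨(z, s), ⟨fun hz ↦ hxc ((hAsec z s).2 (mem_singleton_iff.1 hz)), mem_univ _⟩,
        rfl⟩
    · exact Or.inr ⟨(z, t), ⟨fun hz ↦ hxc ((hBsec z t).2 (mem_singleton_iff.1 hz)), mem_univ _⟩,
        rfl⟩
  · rintro (⟨⟨z, s⟩, ⟨hz, -⟩, rfl⟩ | ⟨⟨z, t⟩, ⟨hz, -⟩, rfl⟩)
    · exact fun h ↦ hz (mem_singleton_iff.2 ((hAsec z s).1 h))
    · exact fun h ↦ hz (mem_singleton_iff.2 ((hBsec z t).1 h))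

/-- The open piece `(0, 1)` of the mapping torus is path connected (convex). [folklore] -/
instance pathConnectedSpace_mappingTorusPieceOne : PathConnectedSpace ↥mappingTorusPieceOne :=
  isPathConnected_iff_pathConnectedSpace.mp <| by
    rw [coe_mappingTorusPieceOne]
    exact (convex_Ioo (0 : ℝ) 1).isPathConnected ⟨2⁻¹, by norm_num⟩

/-- The open piece `(1/2, 3/2)` of the mapping torus is path connected (convex). [folklore] -/
instance pathConnectedSpace_mappingTorusPieceTwo : PathConnectedSpace ↥mappingTorusPieceTwo :=
  isPathConnected_iff_pathConnectedSpace.mp <| by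
    rw [coe_mappingTorusPieceTwo]
    exact (convex_Ioo (1 / 2 : ℝ) (3 / 2)).isPathConnected ⟨1, by norm_num⟩

/-- **The complement of the section circle is path connected**: it is the union of the images of
the two punctured cylinders `(T³ ∖ 1) × (0, 1)`, `(T³ ∖ 1) × (1/2, 3/2)` (path connected, since
`T³ ∖ 1` is), which meet at `jA (z, 3/4) = jB (z, 3/4)`. Used in the reduction
`simplyConnectedSpace_of_isCappellShanesonSphere_of` for `PathConnectedSpace ↥ν.complement`
(path-connectedness of the piece `U = jA' (T ∖ c)` of the surgery cover); `jA_mem_section_iff`,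
`jB_mem_section_iff` are also used by the sibling file `CappellShanesonProofs.lean` to locate the
section circle in the model mapping torus. [folklore] -/
theorem isPathConnected_compl_section
    (hT : IsOpenGluingWith (ModelWithCorners.prod 𝓣 𝓘(ℝ, ℝ)) (ModelWithCorners.prod 𝓣 𝓘(ℝ, ℝ))
      (𝓡 4) (mappingTorusRel ⇑(torusDiffeomorph A)) jA jB) :
    IsPathConnected (jA '' ({1} ×ˢ univ) ∪ jB '' ({1} ×ˢ univ))ᶜ := by
  rw [compl_section_eq hT]
  obtain ⟨hAe, -, hBe, -, -, hR⟩ := hT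
  have hP := isPathConnected_compl_one_threeTorus
  have h1 : IsPathConnected (jA '' ({1}ᶜ ×ˢ univ)) :=
    (hP.prod isPathConnected_univ).image' hAe.isEmbedding.continuous.continuousOn
  have h2 : IsPathConnected (jB '' ({1}ᶜ ×ˢ univ)) :=
    (hP.prod isPathConnected_univ).image' hBe.isEmbedding.continuous.continuousOn
  -- a common point: `jA (z₀, 3/4) = jB (z₀, 3/4)` with `z₀ ≠ 1`
  obtain ⟨z₀, hz₀⟩ := hP.nonempty
  let s₀ : ↥mappingTorusPieceOne := ⟨3 / 4, by rw [← SetLike.mem_coe, coe_mappingTorusPieceOne]; norm_num⟩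
  let t₀ : ↥mappingTorusPieceTwo := ⟨3 / 4, by rw [← SetLike.mem_coe, coe_mappingTorusPieceTwo]; norm_num⟩
  have heq : jA (z₀, s₀) = jB (z₀, t₀) := (hR _ _).2 (Or.inl ⟨rfl, rfl⟩)
  refine h1.union h2 ⟨jA (z₀, s₀), ⟨(z₀, s₀), ⟨hz₀, mem_univ _⟩, rfl⟩, ?_⟩
  exact ⟨(z₀, t₀), ⟨hz₀, mem_univ _⟩, heq.symm⟩

end SectionComplement

/-! ### The push-off of the core circle of a tubular neighbourhood -/

end CappellShaneson

namespace CircleNbhd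

universe u

variable {X : Type u} [TopologicalSpace X] [ChartedSpace (𝔼 4) X] {c : 𝕊 1 → X}
  (ν : CircleNbhd (𝓡 4) c) [T2Space X]

/-- The point `ν (u, w)`, `w ≠ 0`, of an open tube around the circle `c`, as a point of the
complement `X ∖ c(𝕊¹)`. [folklore] -/
def tubePt (u : 𝕊 1) {w : 𝔼 3} (hw : w ≠ 0) : ↥ν.complement :=
  ⟨ν.toFun (u, w), by rw [CircleNbhd.mem_complement_iff, ν.apply_mem_range_iff]; exact hw⟩

/-- Underlying point of `tubePt`. [folklore] -/
@[simp] theorem coe_tubePt (u : 𝕊 1) {w : 𝔼 3} (hw : w ≠ 0) :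
    (ν.tubePt u hw : X) = ν.toFun (u, w) := rfl

/-- `u ↦ tubePt u w` is continuous. [folklore] -/
theorem continuous_tubePt {w : 𝔼 3} (hw : w ≠ 0) : Continuous fun u : 𝕊 1 ↦ ν.tubePt u hw :=
  Continuous.subtype_mk (ν.isSmoothEmbedding.isEmbedding.continuous.comp
    (continuous_id.prodMk continuous_const)) _

/-- **The push-off of the core circle.** For an open tubular neighbourhood `ν : 𝕊¹ × ℝ³ ↪ X` of
the circle `c` and a non-zero normal vector `w`, the loop `t ↦ ν ((cos 2πt, sin 2πt), w)` in the
complement `X ∖ c(𝕊¹)`, based at `ν ((1, 0), w)`: a parallel copy ("longitude") of `c` on the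
boundary of the smaller tube of radius `‖w‖`, i.e. the curve `𝕊¹ × {w}` which bounds the disc
`D² × {pt}` after surgery on `c` (Gompf–Stipsicz, *4-Manifolds and Kirby Calculus*, §5.2).
[folklore] -/
def pushOff {w : 𝔼 3} (hw : w ≠ 0) : Path (ν.tubePt ptA hw) (ν.tubePt ptA hw) where
  toFun t := ν.tubePt (circlePt t) hw
  continuous_toFun := (ν.continuous_tubePt hw).comp (continuous_circlePt.comp continuous_subtype_val)
  source' := by simp [ptA]
  target' := by
    simp only [Set.Icc.coe_one]
    rw [← zero_add (1 : ℝ), circlePt_add_one]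
    rfl

/-- Values of the push-off loop. [folklore] -/
theorem pushOff_apply {w : 𝔼 3} (hw : w ≠ 0) (t : I) :
    ν.pushOff hw t = ν.tubePt (circlePt t) hw := rfl

end CircleNbhd

namespace CappellShaneson

/-! ### The named fact: the group of the section-circle complement -/

/-- **The group of the complement of the section circle of a Cappell–Shaneson mapping torus is
normally generated by a push-off of the circle.** Let `A ∈ SL(3, ℤ)` with `det (A - 1) = ±1`, let
the closed 4-manifold `T` be a mapping torus of the linear diffeomorphism `torusDiffeomorph A` of
`T³` (glued from `T³ × (0, 1)` and `T³ × (1/2, 3/2)` by `jA`, `jB` along `mappingTorusRel`), let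
`c : 𝕊¹ → T` be the section circle through the fixed point `1`
(`range c = jA ({1} × (0,1)) ∪ jB ({1} × (1/2,3/2))`) and `ν : 𝕊¹ × ℝ³ ↪ T` an open tubular
neighbourhood of `c` (either framing). Then for every `w ≠ 0` the fundamental group
`π₁(T ∖ c(𝕊¹), ν((1,0), w))` is the normal closure of the class of the push-off
`t ↦ ν((cos 2πt, sin 2πt), w)` (`CircleNbhd.pushOff`). This is the group-theoretic content of
Cappell–Shaneson's observation that surgery on `c` turns `T` into a simply connected (indeed
homotopy-) 4-sphere exactly when `det (A - 1) = ±1` (Cappell–Shaneson, *Some new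
four-manifolds*, Ann. of Math. 104 (1976), §2; Gompf, Algebr. Geom. Topol. 10 (2010), §2,
p. 1667: "`X^ε_φ` is a homotopy 4-sphere if and only if `det (A - I) = ±1`"; Gompf, Topology
Appl. 38 (1991), p. 124: "it is easy to verify that surgery on this zero section produces a
homotopy 4-sphere"); it is not printed verbatim in these sources. Proof in print: `T ∖ c` is the
mapping torus of `A` on `T³ ∖ 1`, with universal cover `ℝ × (ℝ³ ∖ ℤ³)` (simply connected by
general position, Hatcher Prop. 1.14 proof) and deck group `Γ = ℤ³ ⋊_A ℤ`, so
`π₁(T ∖ c) ≅ Γ` (Hatcher, *Algebraic Topology*, Prop. 1.40); the push-off is homotopic in the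
tube to `c` traversed once, so it maps to `(n₀, ±1) ∈ Γ`, whose normal closure contains the
commutators `((A^{±1} - 1) m, 0)`, `m ∈ ℤ³`, i.e. all of `ℤ³ × 0` because `A - 1` is invertible
over `ℤ`, hence is `Γ`. See `simplyConnectedSpace_of_isCappellShanesonSphere_of` for the use.
[cite: CappellShanesonAnnals1976, §2] -/
def normalClosure_pushOff_eq_top : Prop :=
  ∀ (A : Matrix.SpecialLinearGroup (Fin 3) ℤ) (_hA : (A.1 - 1).det = 1 ∨ (A.1 - 1).det = -1)
    (T : Type) [TopologicalSpace T] [T2Space T] [SecondCountableTopology T] [CompactSpace T]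
    [ChartedSpace (𝔼 4) T] [IsManifold (𝓡 4) ∞ T]
    (jA : ThreeTorus × ↥mappingTorusPieceOne → T) (jB : ThreeTorus × ↥mappingTorusPieceTwo → T)
    (_hT : IsOpenGluingWith (ModelWithCorners.prod 𝓣 𝓘(ℝ, ℝ)) (ModelWithCorners.prod 𝓣 𝓘(ℝ, ℝ))
      (𝓡 4) (mappingTorusRel ⇑(torusDiffeomorph A)) jA jB)
    (c : 𝕊 1 → T) (_hc : Manifold.IsSmoothEmbedding (𝓡 1) (𝓡 4) ∞ c)
    (_hcr : range c = jA '' ({1} ×ˢ univ) ∪ jB '' ({1} ×ˢ univ))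
    (ν : CircleNbhd (𝓡 4) c) (w : 𝔼 3) (hw : w ≠ 0),
    Subgroup.normalClosure
        {(FundamentalGroup.fromPath (Path.Homotopic.Quotient.mk (ν.pushOff hw)) :
          FundamentalGroup (↥ν.complement) (ν.tubePt ptA hw))} = ⊤

/-! ### Geometry of the surgery gluing -/

section Surgery

universe u

variable {T : Type} [TopologicalSpace T] [ChartedSpace (𝔼 4) T] {c : 𝕊 1 → T}
  (ν : CircleNbhd (𝓡 4) c)

/-- The normal vector `halfVec = (1/2, 0, 0)` of `CircleSurgeryExistence` has norm `1/2`. [folklore] -/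
theorem norm_halfVec : ‖CircleNbhd.halfVec‖ = 2⁻¹ := by
  simp [CircleNbhd.halfVec, norm_smul]

/-- The punctured unit ball `B³ ∖ 0` is path connected: it is the image of `(0, 1) × 𝕊²` under
`(t, v) ↦ t • v`. [folklore] -/
theorem isPathConnected_puncturedBall :
    IsPathConnected {w : 𝔼 3 | w ≠ 0 ∧ ‖w‖ < 1} := by
  have h1 : IsPathConnected (Metric.sphere (0 : 𝔼 3) 1) := by
    apply isPathConnected_sphere
    · rw [← Module.finrank_eq_rank, finrank_euclideanSpace_fin]
      norm_num
    · norm_num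
  have h2 : IsPathConnected (Ioo (0 : ℝ) 1) := (convex_Ioo (0 : ℝ) 1).isPathConnected ⟨2⁻¹, by norm_num⟩
  have h := (h2.prod h1).image (f := fun p : ℝ × 𝔼 3 ↦ p.1 • p.2) (by fun_prop)
  convert h using 1
  ext w
  simp only [mem_setOf_eq, mem_image, mem_prod, mem_Ioo, mem_sphere_iff_norm, sub_zero,
    Prod.exists]
  constructor
  · rintro ⟨hw0, hw1⟩
    have hn : 0 < ‖w‖ := norm_pos_iff.2 hw0
    refine ⟨‖w‖, ‖w‖⁻¹ • w, ⟨⟨hn, hw1⟩, ?_⟩, ?_⟩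
    · rw [norm_smul, norm_inv, norm_norm, inv_mul_cancel₀ hn.ne']
    · rw [smul_smul, mul_inv_cancel₀ hn.ne', one_smul]
  · rintro ⟨t, v, ⟨⟨ht0, ht1⟩, hv⟩, rfl⟩
    refine ⟨?_, ?_⟩
    · rw [smul_ne_zero_iff]
      exact ⟨ht0.ne', fun h ↦ by simp [h] at hv⟩
    · rw [norm_smul, hv, mul_one, Real.norm_of_nonneg ht0.le]
      exact ht1

/-- The punctured open tube `ν(𝕊¹ × (B³ ∖ 0))` is path connected. [folklore] -/
theorem isPathConnected_puncturedTube : IsPathConnected ν.puncturedTube := by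
  haveI : PathConnectedSpace (𝕊 1) := by
    refine isPathConnected_iff_pathConnectedSpace.mp (isPathConnected_sphere ?_ _ zero_le_one)
    rw [← Module.finrank_eq_rank, finrank_euclideanSpace_fin]
    norm_num
  have h := (isPathConnected_univ.prod isPathConnected_puncturedBall).image'
    (f := ν.toFun) ν.continuous.continuousOn
  convert h using 1
  ext x
  simp [CircleNbhd.puncturedTube]

/-- `D̊² × 𝕊²` is homeomorphic to the product of the open unit disc and `𝕊²`. [folklore] -/
def discTimesSphereHomeo : ↥discTimesSphere ≃ₜ ↥(Metric.ball (0 : 𝔼 2) 1) × (𝕊 2) where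
  toFun p := (⟨(p : (𝔼 2) × (𝕊 2)).1, mem_ball_zero_iff.2 p.2⟩, (p : (𝔼 2) × (𝕊 2)).2)
  invFun q := ⟨((q.1 : 𝔼 2), q.2), by
    rw [mem_discTimesSphere_iff]; exact mem_ball_zero_iff.1 q.1.2⟩
  left_inv p := rfl
  right_inv q := rfl
  continuous_toFun := by fun_prop
  continuous_invFun := by fun_prop

/-- `D̊² × 𝕊²` is simply connected (`D̊²` is convex, `π₁(𝕊²) = 1`: Hatcher, Prop. 1.14). [folklore] -/
instance simplyConnectedSpace_discTimesSphere : SimplyConnectedSpace ↥discTimesSphere := by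
  haveI : ContractibleSpace ↥(Metric.ball (0 : 𝔼 2) 1) :=
    (convex_ball (0 : 𝔼 2) 1).contractibleSpace ⟨0, Metric.mem_ball_self one_pos⟩
  haveI : SimplyConnectedSpace (𝕊 2) := simplyConnectedSpace_euclideanSphere (n := 2) le_rfl
  haveI : SimplyConnectedSpace (↥(Metric.ball (0 : 𝔼 2) 1) × (𝕊 2)) := Literature.Topology.FourManifolds.simplyConnectedSpace_prod
  exact discTimesSphereHomeo.toHomotopyEquiv.simplyConnectedSpace

variable [T2Space T]

/-- The punctured tube, seen in the complement `T ∖ c(𝕊¹)`, is path connected. [folklore] -/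
theorem isPathConnected_preimage_puncturedTube :
    IsPathConnected {a : ↥ν.complement | (a : T) ∈ ν.puncturedTube} := by
  rw [Topology.IsInducing.subtypeVal.isPathConnected_iff]
  convert isPathConnected_puncturedTube ν using 1
  ext x
  constructor
  · rintro ⟨a, ha, rfl⟩; exact ha
  · intro hx; exact ⟨⟨x, ν.puncturedTube_subset_compl_range hx⟩, hx, rfl⟩

end Surgery

/-! ### The reduction -/

section Reduction

universe u

/-- **Cappell–Shaneson spheres are simply connected**, granted the named fact
`normalClosure_pushOff_eq_top` on the group of the section-circle complement
(Cappell–Shaneson, Ann. of Math. 104 (1976), §2). Proof: a Cappell–Shaneson sphere `X` is the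
open gluing of `U = jA' (T ∖ c)` and `V = jB' (D̊² × 𝕊²)` with `U ∩ V = jA' (ν(𝕊¹ × (B³ ∖ 0)))`
path connected; loops in `V` are null-homotopic in `X` since `D̊² × 𝕊²` is simply connected; a
loop in `U` based at `x₀ = jA' (ν((1,0), w₀))`, `‖w₀‖ = 1/2`, lifts to a loop of `T ∖ c`, and
`(jA')_* : π₁(T ∖ c) → π₁(X, x₀)` is trivial because its kernel is normal and contains the class of
the push-off `𝕊¹ × {w₀}`, which runs in `U ∩ V ⊆ V`; Hatcher's Lemma 1.15
(`Literature.Topology.FourManifolds.simplyConnectedSpace_of_isOpen_cover_of_loops`) then kills every loop of `X`. The binders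
are exactly those of the constant `SPC4.simplyConnectedSpace_of_isCappellShanesonSphere` (a
charted space `X`; `IsCappellShanesonSphere X` needs no more), so that the discharge `…_holds` is a
direct application. [cite: CappellShanesonAnnals1976, §2] -/
theorem simplyConnectedSpace_of_isCappellShanesonSphere_of (hW : normalClosure_pushOff_eq_top)
    (X : Type u) [TopologicalSpace X] [ChartedSpace (𝔼 4) X] :
    FourManifolds.simplyConnectedSpace_of_isCappellShanesonSphere X := by
  intro h
  obtain ⟨A, hA, T, _, _, _, _, _, _, jA, jB, hT, c, hc, hcr, ν, jA', jB', hA', hAo', hB', hBo',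
    hU, hR⟩ := h
  have hjA' : Continuous jA' := hA'.isEmbedding.continuous
  have hjB' : Continuous jB' := hB'.isEmbedding.continuous
  -- points of the punctured tube are glued to the new piece
  have hAV : ∀ a : ↥ν.complement, (a : T) ∈ ν.puncturedTube → jA' a ∈ range jB' := by
    intro a ha
    refine ⟨ν.glue a, ?_⟩
    rw [eq_comm, hR, ν.circleSurgeryRel_iff, CircleNbhd.glueData_glue]
    exact ⟨ha, rfl⟩
  -- base points
  let a₀ : ↥ν.complement := ν.tubePt ptA CircleNbhd.halfVec_ne_zero
  have ha₀ : (a₀ : T) ∈ ν.puncturedTube := by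
    rw [CircleNbhd.coe_tubePt, ν.apply_mem_puncturedTube_iff]
    exact ⟨CircleNbhd.halfVec_ne_zero, by rw [norm_halfVec]; norm_num⟩
  let x₀ : X := jA' a₀
  have hx₀U : x₀ ∈ range jA' := ⟨a₀, rfl⟩
  have hx₀V : x₀ ∈ range jB' := hAV a₀ ha₀
  -- the intersection of the two open pieces
  have hUV : range jA' ∩ range jB' = jA' '' {a | (a : T) ∈ ν.puncturedTube} := by
    ext p
    constructor
    · rintro ⟨⟨a, rfl⟩, ⟨b, hb⟩⟩
      refine ⟨a, ?_, rfl⟩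
      have h := ((hR a b).1 hb.symm)
      rw [ν.circleSurgeryRel_iff] at h
      exact h.1
    · rintro ⟨a, ha, rfl⟩
      exact ⟨⟨a, rfl⟩, hAV a ha⟩
  have hmeet : IsPathConnected (range jA' ∩ range jB') := by
    rw [hUV]
    exact (isPathConnected_preimage_puncturedTube ν).image hjA'
  -- the piece `V = jB' (D̊² × 𝕊²)` is simply connected
  have hVsc : IsSimplyConnected (range jB') := by
    rw [← image_univ, hB'.isEmbedding.isSimplyConnected_image]
    exact (Homeomorph.Set.univ (↥discTimesSphere)).toHomotopyEquiv.simplyConnectedSpace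
  have hloopV : ∀ δ : Path x₀ x₀, (∀ s, δ s ∈ range jB') → δ.Homotopic (Path.refl x₀) := by
    intro δ hδ
    obtain ⟨F, -⟩ := (isSimplyConnected_iff_exists_homotopy_refl_forall_mem.mp hVsc).2 x₀ δ hδ
    exact ⟨F⟩
  -- the push-off dies in `X`: it runs in `V`
  have hpo : ((ν.pushOff CircleNbhd.halfVec_ne_zero).map hjA').Homotopic (Path.refl x₀) := by
    refine hloopV _ fun s ↦ hAV _ ?_
    rw [ν.pushOff_apply, CircleNbhd.coe_tubePt, ν.apply_mem_puncturedTube_iff]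
    exact ⟨CircleNbhd.halfVec_ne_zero, by rw [norm_halfVec]; norm_num⟩
  -- hence `(jA')_*` is trivial on `π₁(T ∖ c, a₀)` (the named fact)
  let φ : FundamentalGroup (↥ν.complement) a₀ →* FundamentalGroup X x₀ :=
    FundamentalGroup.map ⟨jA', hjA'⟩ a₀
  have hφ : ∀ δ : Path a₀ a₀,
      φ (FundamentalGroup.fromPath (Path.Homotopic.Quotient.mk δ)) =
        FundamentalGroup.fromPath (Path.Homotopic.Quotient.mk (δ.map hjA')) := fun δ ↦ rfl
  have hker : φ.ker = ⊤ := by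
    refine top_le_iff.mp ?_
    rw [← hW A hA T jA jB hT c hc hcr ν CircleNbhd.halfVec CircleNbhd.halfVec_ne_zero]
    refine Subgroup.normalClosure_le_normal ?_
    rintro _ rfl
    rw [SetLike.mem_coe, MonoidHom.mem_ker, hφ, FundamentalGroup.one_def,
      ← Path.Homotopic.Quotient.mk_refl]
    exact Path.Homotopic.Quotient.eq.mpr hpo
  -- loops in `U = jA' (T ∖ c)` die in `X`
  have hloopU : ∀ δ : Path x₀ x₀, (∀ s, δ s ∈ range jA') → δ.Homotopic (Path.refl x₀) := by
    intro δ hδ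
    let eA := hA'.isEmbedding.toHomeomorph
    have hlift : ∀ s : I, jA' (eA.symm ⟨δ s, hδ s⟩) = δ s := by
      intro s
      have h := congrArg Subtype.val (eA.apply_symm_apply ⟨δ s, hδ s⟩)
      rwa [Topology.IsEmbedding.toHomeomorph_apply_coe] at h
    have hends : eA.symm ⟨x₀, hx₀U⟩ = a₀ := hA'.isEmbedding.toHomeomorph_symm_apply a₀
    let δ' : Path a₀ a₀ :=
      { toFun := fun s ↦ eA.symm ⟨δ s, hδ s⟩
        continuous_toFun := eA.symm.continuous.comp (δ.continuous.subtype_mk _)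
        source' := by
          have h0 : (⟨δ 0, hδ 0⟩ : range jA') = ⟨x₀, hx₀U⟩ := Subtype.ext δ.source
          simp only [h0, hends]
        target' := by
          have h1 : (⟨δ 1, hδ 1⟩ : range jA') = ⟨x₀, hx₀U⟩ := Subtype.ext δ.target
          simp only [h1, hends] }
    have hδ' : δ'.map hjA' = δ := by
      ext s
      exact hlift s
    have h1 : φ (FundamentalGroup.fromPath (Path.Homotopic.Quotient.mk δ')) = 1 := by
      rw [← MonoidHom.mem_ker, hker]
      exact Subgroup.mem_top _
    rw [hφ, FundamentalGroup.one_def, ← Path.Homotopic.Quotient.mk_refl, hδ'] at h1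
    exact Path.Homotopic.Quotient.eq.mp h1
  -- path-connectedness of the pieces
  haveI : PathConnectedSpace ↥ν.complement := by
    refine isPathConnected_iff_pathConnectedSpace.mp ?_
    change IsPathConnected ((range c)ᶜ : Set T)
    rw [hcr]
    exact isPathConnected_compl_section hT
  have hUpc : IsPathConnected (range jA') := isPathConnected_range hjA'
  have hVpc : IsPathConnected (range jB') := isPathConnected_range hjB'
  exact simplyConnectedSpace_of_isOpen_cover_of_loops hAo' hBo' hU hx₀U hx₀V hUpc hVpc hloopU
    hloopV hmeet

end Reduction

end CappellShaneson

end Literature.Topology.FourManifolds
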